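import Summits.HodgeConjecture.HodgeConjecture.Theorems.ELineTransportELineConnectivityRGeneric
import Summits.HodgeConjecture.HodgeConjecture.Theorems.ELineTransportELineConnectivityRNode

/-!
# Route `ELineTransport` — support item `ELineConnectivityR` (stmt-HodgeConjecture-13981):
# generic E-twistor connectivity — assembly

Proof of `Theses.ELineTransport.ELineConnectivityR`: for an E-structure `Jm` on
`(ℚ²², D = diag(1,1,1,-1,…,-1))` (`Jm² = m`, `m` a non-square, `D`-self-adjoint) and two GENERIC
positive `3`-planes `W₀, W₁` of the real `(+√m)`-eigenspace `E₊` (`W_i^⊥ ∩ ℚ²² = 0`), there is a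
chain of positive `3`-planes of `E₊` from `W₀` to `W₁` whose consecutive members share a period
vector `x` (`Jm x = √m x`, `x·x = 0`, `x̄·x > 0`) with `NS(x) = 0` and `End_Hdg(x) = ℚ + ℚ·Jm`.

THE CHAIN (length `3`, parts 1–6 of this series):
`W₀ ⊃ ⟨s, n⟩ ⊂ U₁ := ⟨F b₁, s, n⟩ ⊃ ⟨F b₁, n⟩ ⊂ U₂ := ⟨F b₁, F b₂, n⟩ ⊃ ⟨F b₁, F b₂⟩ ⊂ W₁`,
where `F : W₀ → W₁` is the transfer map (projection onto `W₁` along `W₀ᗮ`, part 1 — `W₀ᗮ` is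
negative definite because the positive index of `D` is `3`, so the TC hypothesis on the
`(−√m)`-eigenspace is not needed), `b₁, b₂ ∈ W₀` are GENERIC parameters (part 5, Baire category),
`s = (b₁.b₁) b₂ − (b₂.b₁) b₁ ⊥ b₁` and `0 ≠ n ∈ W₀ ∩ {b₁, b₂}^⊥`. The three shared planes are
positive definite and contain the WITNESSES `s`, `F b₁`, `F b₁`, which are orthogonal to no
non-zero rational vector (so `NS(x) = 0` for their period vectors, part 2) and lie in none of the
countably many CM planes (so `End_Hdg(x) = ℚ + ℚ·Jm` by Schur's lemma and the degree dichotomy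
`[End : ℚ] ∈ {2, 22}`, parts 3, 4, 6). Mathematically this is Huybrechts, *Lectures on K3
surfaces*, Ch. 7 §3.1 Prop. 3.2 (after Beauville) inside `E₊`, with the stronger node condition.
No definitions, no named facts, no sorry; the TC hypothesis of the statement is idle.
-/

-- `Summit.HodgeConjecture.HodgeConjecture.…` (summit = problem) duplicates a namespace component by design (D-0017).
set_option linter.dupNamespace false

noncomputable section

open Matrix Module

namespace Summit.HodgeConjecture.HodgeConjecture.Theorems

local notation3 "Dℝ" => (Matrix.diagonal (fun i : Fin 22 => if i.val < 3 then (1 : ℝ) else -1))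
local notation3 "BR" => (Matrix.toBilin' (Matrix.diagonal
  (fun i : Fin 22 => if i.val < 3 then (1 : ℝ) else -1)) : LinearMap.BilinForm ℝ (Fin 22 → ℝ))

namespace ELineConnR

/-- In a `3`-plane there is a non-zero vector orthogonal to two given vectors. [folklore] -/
theorem exists_perp_pair {W₀ : Submodule ℝ (Fin 22 → ℝ)} (hW₀3 : finrank ℝ W₀ = 3)
    (b₁ b₂ : Fin 22 → ℝ) : ∃ n ∈ W₀, n ≠ 0 ∧ BR b₁ n = 0 ∧ BR b₂ n = 0 := by
  set φ : W₀ →ₗ[ℝ] ℝ × ℝ := ((BR b₁).comp W₀.subtype).prod ((BR b₂).comp W₀.subtype) with hφ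
  have h := LinearMap.finrank_range_add_finrank_ker φ
  have hr : finrank ℝ (LinearMap.range φ) ≤ 2 :=
    (Submodule.finrank_le _).trans (by simp)
  rw [hW₀3] at h
  have hk : 0 < finrank ℝ (LinearMap.ker φ) := by omega
  obtain ⟨⟨⟨n, hnW⟩, hker⟩, hne⟩ :=
    (Module.finrank_pos_iff_exists_ne_zero (R := ℝ) (M := LinearMap.ker φ)).1 hk
  refine ⟨n, hnW, fun h0 => hne (Subtype.ext (Subtype.ext h0)), ?_, ?_⟩
  · have := congrArg Prod.fst (LinearMap.mem_ker.1 hker)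
    simpa [hφ] using this
  · have := congrArg Prod.snd (LinearMap.mem_ker.1 hker)
    simpa [hφ] using this

/-- The span of two common members of two subspaces lies in their intersection. [folklore] -/
theorem span_pair_le_inf {A C : Submodule ℝ (Fin 22 → ℝ)} {p₁ p₂ : Fin 22 → ℝ}
    (h1A : p₁ ∈ A) (h2A : p₂ ∈ A) (h1C : p₁ ∈ C) (h2C : p₂ ∈ C) :
    Submodule.span ℝ ({p₁, p₂} : Set (Fin 22 → ℝ)) ≤ A ⊓ C := by
  rw [Submodule.span_le]
  intro p hp
  simp only [Set.mem_insert_iff, Set.mem_singleton_iff] at hp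
  rcases hp with rfl | rfl
  · exact ⟨h1A, h1C⟩
  · exact ⟨h2A, h2C⟩

end ELineConnR

open ELineConnR TwinTwistorTransport.MukaiLift in
/-- **Generic E-twistor connectivity** (route `ELineTransport`, support item
`ELineConnectivityR`, stmt-HodgeConjecture-13981): any two generic positive `3`-planes of the
`(+√m)`-eigenspace of an E-structure on the rational K3 form are joined by a chain of positive
`3`-planes whose consecutive members share a period vector with `NS = 0` and
`End_Hdg = ℚ + ℚ·Jm`. See the module docstring for the proof. [folklore; Huybrechts2016K3
Ch. 7 §3.1 Prop. 3.2 pattern] -/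
theorem eLineTransport_eLineConnectivityR_proof : Theses.ELineTransport.ELineConnectivityR := by
  intro m hm Jm hJ2 hJsa _
  dsimp only
  intro W₀ W₁ hW₀ hW₁ hg₀ hg₁
  obtain ⟨hW₀E, hW₀3, hW₀q⟩ := hW₀
  obtain ⟨hW₁E, hW₁3, hW₁q⟩ := hW₁
  -- the real form as a bilinear form
  have hW₀pos : ∀ u ∈ W₀, u ≠ 0 → 0 < (Matrix.toBilin' Dℝ) u u := fun u hu h0 => by
    rw [← q_eq_toBilin]; exact hW₀q u hu h0
  have hW₁pos : ∀ u ∈ W₁, u ≠ 0 → 0 < (Matrix.toBilin' Dℝ) u u := fun u hu h0 => by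
    rw [← q_eq_toBilin]; exact hW₁q u hu h0
  have hg₀' : ∀ l : Fin 22 → ℚ, (∀ u ∈ W₀, (Matrix.toBilin' Dℝ) (fun j => ((l j : ℚ) : ℝ)) u = 0) →
      l = 0 := fun l hl => hg₀ l (fun u hu => by rw [q_eq_toBilin]; exact hl u hu)
  have hg₁' : ∀ l : Fin 22 → ℚ, (∀ u ∈ W₁, (Matrix.toBilin' Dℝ) (fun j => ((l j : ℚ) : ℝ)) u = 0) →
      l = 0 := fun l hl => hg₁ l (fun u hu => by rw [q_eq_toBilin]; exact hl u hu)
  -- eigen-equation on `E₊`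
  have heig : ∀ w ∈ LinearMap.ker (Matrix.toLin' (Jm.map (fun x : ℚ => (x : ℝ))) -
      Real.sqrt m • LinearMap.id), (Jm.map (fun x : ℚ => (x : ℝ))) *ᵥ w = Real.sqrt m • w := by
    intro w hw
    rw [LinearMap.mem_ker, LinearMap.sub_apply, LinearMap.smul_apply, Matrix.toLin'_apply,
      LinearMap.id_apply, sub_eq_zero] at hw
    exact hw
  -- the transfer map
  obtain ⟨π, hπ₁, hπ₀, -, hπsurj, hπpos⟩ := exists_transfer hW₀3 hW₀pos hW₁3 hW₁pos
  have hπW₀ : ∀ w, ∀ u ∈ W₀, (Matrix.toBilin' Dℝ) u (π w) = (Matrix.toBilin' Dℝ) u w := by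
    intro w u hu
    have := hπ₀ w u hu
    rw [LinearMap.BilinForm.sub_right, sub_eq_zero] at this
    exact this
  -- the CM planes
  haveI : Countable (Matrix (Fin 22) (Fin 22) ℚ) :=
    inferInstanceAs (Countable (Fin 22 → Fin 22 → ℚ))
  obtain ⟨Q, hQdef⟩ : ∃ Q : Matrix (Fin 22) (Fin 22) ℚ × ℕ → Submodule ℝ (Fin 22 → ℝ), ∀ p,
      Q p = Submodule.span ℝ
      ({fun j => (Classical.epsilon (fun y : Fin 22 → ℂ => y ≠ 0 ∧
          (p.1.map (fun t : ℚ => (t : ℂ))) *ᵥ y =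
            (((p.1.map (fun t : ℚ => (t : ℂ))).charpoly.roots.toList.getD p.2 0) • y)) j).re,
        fun j => (Classical.epsilon (fun y : Fin 22 → ℂ => y ≠ 0 ∧
          (p.1.map (fun t : ℚ => (t : ℂ))) *ᵥ y =
            (((p.1.map (fun t : ℚ => (t : ℂ))).charpoly.roots.toList.getD p.2 0) • y)) j).im} :
        Set (Fin 22 → ℝ)) := ⟨_, fun p => rfl⟩
  have hQ2 : ∀ p, finrank ℝ (Q p) ≤ 2 := by
    intro p
    rw [hQdef p, ← Finset.coe_pair]
    exact (finrank_span_finset_le_card _).trans Finset.card_le_two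
  -- generic parameters
  obtain ⟨b₁, hb₁, b₂, hb₂, hs0, hNSs, hNSF, hCMs, hCMF⟩ :=
    exists_generic_pair W₀ W₁ hW₀3 hW₀pos hW₁3 hg₀' hg₁' π hπsurj Q hQ2
  obtain ⟨s, hs⟩ : ∃ s : Fin 22 → ℝ,
      s = (Matrix.toBilin' Dℝ) b₁ b₁ • b₂ - (Matrix.toBilin' Dℝ) b₂ b₁ • b₁ := ⟨_, rfl⟩
  rw [← hs] at hs0 hNSs hCMs
  obtain ⟨n, hnW, hn0, hb₁n, hb₂n⟩ := exists_perp_pair hW₀3 b₁ b₂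
  -- elementary facts about `b₁, b₂, s, n, π b₁, π b₂`
  have hsW : s ∈ W₀ := by rw [hs]; exact W₀.sub_mem (W₀.smul_mem _ hb₂) (W₀.smul_mem _ hb₁)
  have hb₁0 : b₁ ≠ 0 := by
    intro h0
    apply hs0
    rw [hs, h0, LinearMap.BilinForm.zero_left, zero_smul, smul_zero, sub_zero]
  have hb₁s : (Matrix.toBilin' Dℝ) b₁ s = 0 := by
    rw [hs, LinearMap.BilinForm.sub_right, LinearMap.BilinForm.smul_right,
      LinearMap.BilinForm.smul_right, form_comm b₂ b₁]
    ring
  have hsn : (Matrix.toBilin' Dℝ) s n = 0 := by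
    rw [hs, LinearMap.BilinForm.sub_left, LinearMap.BilinForm.smul_left,
      LinearMap.BilinForm.smul_left, hb₂n, hb₁n, mul_zero, mul_zero, sub_zero]
  have hss : 0 < (Matrix.toBilin' Dℝ) s s := hW₀pos s hsW hs0
  have hnn : 0 < (Matrix.toBilin' Dℝ) n n := hW₀pos n hnW hn0
  have hπ₁s : (Matrix.toBilin' Dℝ) (π b₁) s = 0 := by rw [form_comm, hπW₀ b₁ s hsW, form_comm, hb₁s]
  have hπ₁n : (Matrix.toBilin' Dℝ) (π b₁) n = 0 := by rw [form_comm, hπW₀ b₁ n hnW, form_comm, hb₁n]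
  have hπ₂n : (Matrix.toBilin' Dℝ) (π b₂) n = 0 := by rw [form_comm, hπW₀ b₂ n hnW, form_comm, hb₂n]
  have hπ₁pos : 0 < (Matrix.toBilin' Dℝ) (π b₁) (π b₁) := hπpos b₁ hb₁ hb₁0
  have hpair : ∀ a b : ℝ, (a ≠ 0 ∨ b ≠ 0) →
      0 < (Matrix.toBilin' Dℝ) (a • π b₁ + b • π b₂) (a • π b₁ + b • π b₂) := by
    intro a b hab
    have hw : a • b₁ + b • b₂ ∈ W₀ := W₀.add_mem (W₀.smul_mem _ hb₁) (W₀.smul_mem _ hb₂)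
    have hw0 : a • b₁ + b • b₂ ≠ 0 := by
      intro h0
      by_cases hb0 : b = 0
      · rw [hb0, zero_smul, add_zero, smul_eq_zero] at h0
        rcases hab with ha | hb
        · rcases h0 with h | h
          · exact ha h
          · exact hb₁0 h
        · exact hb hb0
      · apply hs0
        have hb₂eq : b₂ = (-(a / b)) • b₁ := by
          have : b • b₂ = -(a • b₁) := eq_neg_of_add_eq_zero_right h0
          calc b₂ = b⁻¹ • (b • b₂) := by rw [smul_smul, inv_mul_cancel₀ hb0, one_smul]
            _ = (-(a / b)) • b₁ := by rw [this, smul_neg, smul_smul, neg_smul, div_eq_inv_mul]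
        rw [hs, hb₂eq, LinearMap.BilinForm.smul_left, smul_smul, mul_comm, sub_self]
    have := hπpos _ hw hw0
    rwa [map_add, map_smul, map_smul] at this
  -- the two middle `3`-planes
  set U₁ : Submodule ℝ (Fin 22 → ℝ) := Submodule.span ℝ (Set.range ![π b₁, s, n]) with hU₁
  set U₂ : Submodule ℝ (Fin 22 → ℝ) := Submodule.span ℝ (Set.range ![π b₁, π b₂, n]) with hU₂
  have ht₁ : ∀ c : Fin 3 → ℝ, c ≠ 0 →
      0 < (Matrix.toBilin' Dℝ) (∑ i, c i • ![π b₁, s, n] i) (∑ i, c i • ![π b₁, s, n] i) :=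
    twistorV_posFamily_of_orthogonal (Matrix.toBilin' Dℝ) form_comm hπ₁s hπ₁n hsn hπ₁pos hss hnn
  have ht₂ : ∀ c : Fin 3 → ℝ, c ≠ 0 →
      0 < (Matrix.toBilin' Dℝ) (∑ i, c i • ![π b₁, π b₂, n] i) (∑ i, c i • ![π b₁, π b₂, n] i) :=
    pos3_of_pair_perp (Matrix.toBilin' Dℝ) form_comm hpair hπ₁n hπ₂n hnn
  have hπb₁E := hW₁E (hπ₁ b₁)
  have hπb₂E := hW₁E (hπ₁ b₂)
  have hsE := hW₀E hsW
  have hnE := hW₀E hnW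
  have hU₁E : U₁ ≤ LinearMap.ker (Matrix.toLin' (Jm.map (fun x : ℚ => (x : ℝ))) -
      Real.sqrt m • LinearMap.id) := by
    rw [hU₁, Submodule.span_le]
    rintro _ ⟨i, rfl⟩
    fin_cases i
    · exact hπb₁E
    · exact hsE
    · exact hnE
  have hU₂E : U₂ ≤ LinearMap.ker (Matrix.toLin' (Jm.map (fun x : ℚ => (x : ℝ))) -
      Real.sqrt m • LinearMap.id) := by
    rw [hU₂, Submodule.span_le]
    rintro _ ⟨i, rfl⟩
    fin_cases i
    · exact hπb₁E
    · exact hπb₂E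
    · exact hnE
  -- generators belong to the spans
  have hπ₁U₁ : π b₁ ∈ U₁ := Submodule.subset_span ⟨0, rfl⟩
  have hsU₁ : s ∈ U₁ := Submodule.subset_span ⟨1, rfl⟩
  have hnU₁ : n ∈ U₁ := Submodule.subset_span ⟨2, rfl⟩
  have hπ₁U₂ : π b₁ ∈ U₂ := Submodule.subset_span ⟨0, rfl⟩
  have hπ₂U₂ : π b₂ ∈ U₂ := Submodule.subset_span ⟨1, rfl⟩
  have hnU₂ : n ∈ U₂ := Submodule.subset_span ⟨2, rfl⟩
  refine ⟨3, ![W₀, U₁, U₂, W₁], rfl, rfl, ?_, ?_⟩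
  · -- the four `3`-planes are positive `3`-planes of `E₊`
    intro i
    fin_cases i
    · exact ⟨hW₀E, hW₀3, hW₀q⟩
    · refine ⟨hU₁E, twistorV_finrank_span (Matrix.toBilin' Dℝ) ht₁, fun u hu hu0 => ?_⟩
      rw [q_eq_toBilin]
      exact twistorV_pos_of_mem_span (Matrix.toBilin' Dℝ) ht₁ hu hu0
    · refine ⟨hU₂E, twistorV_finrank_span (Matrix.toBilin' Dℝ) ht₂, fun u hu hu0 => ?_⟩
      rw [q_eq_toBilin]
      exact twistorV_pos_of_mem_span (Matrix.toBilin' Dℝ) ht₂ hu hu0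
    · exact ⟨hW₁E, hW₁3, hW₁q⟩
  · -- the three links
    intro i
    fin_cases i
    · -- `W₀ ∩ U₁ ⊇ ⟨s, n⟩`, witness `s`
      obtain ⟨x, h1, h2, h3, h4, h5, h6, h7⟩ := exists_node hm hJ2 hJsa (heig s hsE) (heig n hnE)
        (fun a b hab => by
          rw [q_eq_toBilin]
          exact posPair_of_orthogonal (Matrix.toBilin' Dℝ) form_comm hsn hss hnn a b hab)
        (fun l hl => by rw [q_eq_toBilin]; exact hNSs l hl) Q hQdef hCMs
      refine ⟨x, h1, h2, h3, ?_, ?_, h6, h7⟩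
      · rw [h4]; exact Submodule.mem_inf.2 ⟨hsW, hsU₁⟩
      · exact span_pair_le_inf hsW hnW hsU₁ hnU₁ h5
    · -- `U₁ ∩ U₂ ⊇ ⟨π b₁, n⟩`, witness `π b₁`
      obtain ⟨x, h1, h2, h3, h4, h5, h6, h7⟩ := exists_node hm hJ2 hJsa (heig _ hπb₁E) (heig n hnE)
        (fun a b hab => by
          rw [q_eq_toBilin]
          exact posPair_of_orthogonal (Matrix.toBilin' Dℝ) form_comm hπ₁n hπ₁pos hnn a b hab)
        (fun l hl => by rw [q_eq_toBilin]; exact hNSF l hl) Q hQdef hCMF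
      refine ⟨x, h1, h2, h3, ?_, ?_, h6, h7⟩
      · rw [h4]; exact Submodule.mem_inf.2 ⟨hπ₁U₁, hπ₁U₂⟩
      · exact span_pair_le_inf hπ₁U₁ hnU₁ hπ₁U₂ hnU₂ h5
    · -- `U₂ ∩ W₁ ⊇ ⟨π b₁, π b₂⟩`, witness `π b₁`
      obtain ⟨x, h1, h2, h3, h4, h5, h6, h7⟩ := exists_node hm hJ2 hJsa (heig _ hπb₁E)
        (heig _ hπb₂E)
        (fun a b hab => by rw [q_eq_toBilin]; exact hpair a b hab)
        (fun l hl => by rw [q_eq_toBilin]; exact hNSF l hl) Q hQdef hCMF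
      refine ⟨x, h1, h2, h3, ?_, ?_, h6, h7⟩
      · rw [h4]; exact Submodule.mem_inf.2 ⟨hπ₁U₂, hπ₁ b₁⟩
      · exact span_pair_le_inf hπ₁U₂ hπ₂U₂ (hπ₁ b₁) (hπ₁ b₂) h5

end Summit.HodgeConjecture.HodgeConjecture.Theorems

end
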